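import Summits.SmoothPoincare4.SmoothPoincare4.Theses.WeylBudget
import Literature.Topology.FourManifolds.GluingProofs
import Literature.Topology.FourManifolds.GluedMetric
import Literature.Topology.FourManifolds.ClosedBallProofs
import Literature.Geometry.Lorentzian.IsometryProofs
import HarnessLib

/-!
# Isometric regluing, transport step: moving a gluing witness and its metric along `X ≅ P`

Support file for the crux `CorkRegluingBudget` (item stmt-SmoothPoincare4-10831, route
WeylBudget, line `registered`, Stub B2 `stub_isometricRegluing`, step (h) of its proof).
Everything here is proved; no definitions, no named facts.

If `X` is the gluing `C ∪_ψ W` of two compact pieces with boundary, witnessed by piece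
embeddings `kC : C → X`, `kW : W → X` (covering `X`, seam relation `kC (ι z) = kW (ι (ψ z))`),
and carries a Riemannian metric `γ`, and `P` is ANY smooth 4-manifold which is also a gluing
`C ∪_ψ W` (`IsBoundaryGluing bC bW ψ (𝓡 4) P`), then `P` carries piece embeddings
`kC' := F ∘ kC`, `kW' := F ∘ kW` (again a gluing witness for `ψ`) and a Riemannian metric
`γ' := (F⁻¹)^* γ` with the SAME piece metrics, `kC'^* γ' = kC^* γ`, `kW'^* γ' = kW^* γ`, where
`F : X ≅ P` is the diffeomorphism provided by the uniqueness of boundary gluings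
(`Literature.Topology.FourManifolds.nonempty_diffeomorph_of_isBoundaryGluing_holds`, Hirsch,
*Differential Topology* (1976), Ch. 8 §2, Thm. 2.1; Bröcker–Jänich (1982), (13.9)) and the
metric identities are the naturality of pullback (O'Neill 1983, Ch. 3, p. 58:
`(F ∘ k)^* (F⁻¹)^* γ = k^* (F⁻¹ ∘ F)^* γ = k^* γ`).

## References

* M. W. Hirsch, *Differential Topology*, GTM 33 (1976), Ch. 8 §2, Thm. 2.1. [HirschDT1976]
* T. Bröcker, K. Jänich, *Introduction to Differential Topology* (1982), §13, (13.9).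
  [BrockerJanich1982]
* B. O'Neill, *Semi-Riemannian Geometry* (1983), Ch. 3, p. 58, pp. 90–91. [ONeill1983]
-/

-- the prescribed namespace `Summit.<P>.<Sub>.…` duplicates `SmoothPoincare4` (P = Sub)
set_option linter.dupNamespace false

open scoped Manifold ContDiff Topology
open Set Function

noncomputable section

namespace Summit.SmoothPoincare4.SmoothPoincare4.Theorems.CorkRegluingBudget

open Literature.Geometry.Lorentzian Literature.Geometry.Lorentzian.PseudoRiemannianMetric
  Literature.Topology.FourManifolds

/-! ### Naturality of the pullback of metrics under a diffeomorphism -/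

section Naturality

variable {X : Type*} [TopologicalSpace X] [ChartedSpace (EuclideanSpace ℝ (Fin 4)) X]
  {P : Type*} [TopologicalSpace P] [ChartedSpace (EuclideanSpace ℝ (Fin 4)) P]

/-- The differential of the inverse of a diffeomorphism is injective (`dF ∘ dF⁻¹ = id`).
[folklore] -/
theorem injective_mfderiv_diffeomorph_symm (F : X ≃ₘ⟮𝓡 4, 𝓡 4⟯ P) (p : P) :
    Injective (mfderiv (𝓡 4) (𝓡 4) F.symm p) := fun v w h ↦ by
  have h' := congrArg (mfderiv (𝓡 4) (𝓡 4) F (F.symm p)) h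
  rwa [mfderiv_apply_mfderiv_symm F p v, mfderiv_apply_mfderiv_symm F p w] at h'

/-- **Naturality of pullback**: `(F ∘ k)^* ((F⁻¹)^* γ) = k^* γ` for a diffeomorphism `F` and a
`C^∞` map `k` (chain rule twice and `F⁻¹ ∘ F = id`). O'Neill 1983, Ch. 3, p. 58.
[cite: ONeill1983, Ch. 3, p. 58] -/
theorem pullbackBilin_comp_diffeomorph_symm {EQ HQ : Type*} [NormedAddCommGroup EQ]
    [NormedSpace ℝ EQ] [TopologicalSpace HQ] {IQ : ModelWithCorners ℝ EQ HQ}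
    {Q : Type*} [TopologicalSpace Q] [ChartedSpace HQ Q]
    (F : X ≃ₘ⟮𝓡 4, 𝓡 4⟯ P) {k : Q → X} (hk : ContMDiff IQ (𝓡 4) ∞ k)
    (b : Π x : X, TangentSpace (𝓡 4) x →L[ℝ] TangentSpace (𝓡 4) x →L[ℝ] ℝ) :
    pullbackBilin (I := 𝓡 4) (I' := IQ) (F ∘ k)
        (pullbackBilin (I := 𝓡 4) (I' := 𝓡 4) F.symm b) =
      pullbackBilin (I := 𝓡 4) (I' := IQ) k b := by
  have hF : MDifferentiable (𝓡 4) (𝓡 4) F := F.contMDiff.mdifferentiable (by simp)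
  have hFs : MDifferentiable (𝓡 4) (𝓡 4) F.symm := F.symm.contMDiff.mdifferentiable (by simp)
  have hkmd : MDifferentiable IQ (𝓡 4) k := hk.mdifferentiable (by simp)
  rw [pullbackBilin_comp hF hkmd, ← pullbackBilin_comp hFs hF]
  have hid : ((F.symm : P → X) ∘ (F : X → P)) = id := funext fun x ↦ F.symm_apply_apply x
  rw [hid, pullbackBilin_id]

end Naturality

/-! ### The transport step -/

/-- **Isometric transport along the uniqueness of gluings** (step (h) of Stub B2
`stub_isometricRegluing` of the crux `CorkRegluingBudget`; it is also the statement of the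
sibling stub `stub_isometricTransport` of the crux `CorkRegluablePsc`).  If `X`, with explicit
piece embeddings `kC, kW` (covering `X`, seam relation along `ψ : ∂C ≅ ∂W`) and a Riemannian
metric `γ`, and `P` are both the gluing `C ∪_ψ W` of the same compact Hausdorff pieces, then `P`
carries piece embeddings `kC', kW'` — again a gluing witness for `ψ` — and a Riemannian `γ'`
with `kC'^* γ' = kC^* γ` and `kW'^* γ' = kW^* γ`.  Proof: `F : X ≅ P` by the uniqueness of
boundary gluings (`nonempty_diffeomorph_of_isBoundaryGluing_holds`, Hirsch Ch. 8 §2 Thm. 2.1),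
`kC' := F ∘ kC`, `kW' := F ∘ kW`, `γ' := (F⁻¹)^* γ` (`PseudoRiemannianMetric.comap`), and
naturality of the pullback. [cite: HirschDT1976, Ch. 8 §2, Thm. 2.1]
[cite: ONeill1983, Ch. 3, p. 58] -/
theorem isometricTransport
    (C : Type) [TopologicalSpace C] [T2Space C]
    [ChartedSpace (EuclideanHalfSpace 4) C] [IsManifold (𝓡∂ 4) ∞ C] [CompactSpace C]
    (bC : BoundaryData (𝓡∂ 4) C (𝓡 3))
    (W : Type) [TopologicalSpace W] [T2Space W]
    [ChartedSpace (EuclideanHalfSpace 4) W] [IsManifold (𝓡∂ 4) ∞ W] [CompactSpace W]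
    (bW : BoundaryData (𝓡∂ 4) W (𝓡 3))
    (ψ : bC.carrier ≃ₘ⟮𝓡 3, 𝓡 3⟯ bW.carrier)
    (X : Type) [TopologicalSpace X] [ChartedSpace (EuclideanSpace ℝ (Fin 4)) X]
    [IsManifold (𝓡 4) ∞ X]
    (P : Type) [TopologicalSpace P] [ChartedSpace (EuclideanSpace ℝ (Fin 4)) P]
    [IsManifold (𝓡 4) ∞ P]
    (kC : C → X) (kW : W → X)
    (γ : PseudoRiemannianMetric (𝓡 4) ∞ (EuclideanSpace ℝ (Fin 4))
      (TangentSpace (𝓡 4) : X → Type _))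
    (hkC : Manifold.IsSmoothEmbedding (𝓡∂ 4) (𝓡 4) ∞ kC)
    (hkW : Manifold.IsSmoothEmbedding (𝓡∂ 4) (𝓡 4) ∞ kW)
    (hcov : range kC ∪ range kW = univ)
    (hseam : ∀ a b, kC a = kW b ↔ ∃ z, a = bC.incl z ∧ b = bW.incl (ψ z))
    (hγ : γ.IsRiemannian)
    (hP : IsBoundaryGluing bC bW ψ (𝓡 4) P) :
    ∃ (kC' : C → P) (kW' : W → P)
      (γ' : PseudoRiemannianMetric (𝓡 4) ∞ (EuclideanSpace ℝ (Fin 4))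
        (TangentSpace (𝓡 4) : P → Type _)),
      Manifold.IsSmoothEmbedding (𝓡∂ 4) (𝓡 4) ∞ kC' ∧
        Manifold.IsSmoothEmbedding (𝓡∂ 4) (𝓡 4) ∞ kW' ∧
        range kC' ∪ range kW' = univ ∧
        (∀ a b, kC' a = kW' b ↔ ∃ z, a = bC.incl z ∧ b = bW.incl (ψ z)) ∧
        γ'.IsRiemannian ∧
        (∀ c, pullbackBilin (I := 𝓡 4) (I' := 𝓡∂ 4) kC' γ'.val c =
          pullbackBilin (I := 𝓡 4) (I' := 𝓡∂ 4) kC γ.val c) ∧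
        (∀ w, pullbackBilin (I := 𝓡 4) (I' := 𝓡∂ 4) kW' γ'.val w =
          pullbackBilin (I := 𝓡 4) (I' := 𝓡∂ 4) kW γ.val w) := by
  -- the comparison diffeomorphism `F : X ≅ P` (uniqueness of boundary gluings)
  have hX : IsBoundaryGluing bC bW ψ (𝓡 4) X := ⟨kC, kW, hkC, hkW, hcov, hseam⟩
  obtain ⟨F⟩ := nonempty_diffeomorph_of_isBoundaryGluing_holds hX hP
  -- the transported metric `γ' := (F⁻¹)^* γ`
  have hFs : ContMDiff (𝓡 4) (𝓡 4) (((⊤ : ℕ∞) : ℕ∞ω) + 1) F.symm := F.symm.contMDiff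
  set γ' : PseudoRiemannianMetric (𝓡 4) ∞ (EuclideanSpace ℝ (Fin 4))
      (TangentSpace (𝓡 4) : P → Type _) :=
    γ.comap (contMDiff_pullbackBilin_holds (I := 𝓡 4) (M := X) (I' := 𝓡 4) (N := P)) F.symm
      hFs (injective_mfderiv_diffeomorph_symm F) rfl with hγ'
  refine ⟨F ∘ kC, F ∘ kW, γ', hkC.diffeomorph_comp F, hkW.diffeomorph_comp F, ?_, ?_, ?_, ?_,
    ?_⟩
  · -- the transported pieces cover `P`
    rw [range_comp, range_comp, ← image_union, hcov, image_univ]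
    exact range_eq_univ.2 F.surjective
  · -- the seam relation is transported along the bijection `F`
    intro a b
    rw [← hseam a b]
    exact F.injective.eq_iff
  · -- positivity is transported (the differential of `F⁻¹` is injective)
    intro p u hu
    rw [hγ', val_comap, pullbackBilin_apply]
    exact hγ _ _ fun h ↦ hu (injective_mfderiv_diffeomorph_symm F p (by rw [h, map_zero]))
  · intro c
    have hval : γ'.val = pullbackBilin (I := 𝓡 4) (I' := 𝓡 4) F.symm γ.val := rfl
    rw [hval, pullbackBilin_comp_diffeomorph_symm F hkC.contMDiff]
  · intro w
    have hval : γ'.val = pullbackBilin (I := 𝓡 4) (I' := 𝓡 4) F.symm γ.val := rfl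
    rw [hval, pullbackBilin_comp_diffeomorph_symm F hkW.contMDiff]

/-- **Registered helper `helper_isometricTransport`** (sub-goal of Stub B2 `stub_isometricRegluing`
of the crux `CorkRegluingBudget`, step (h)): the statement of `isometricTransport` in registered
binder form — if `X` (with piece embeddings `kC, kW` covering it, seam relation along `ψ`, and a
Riemannian `γ`) and `P` are both the gluing `C ∪_ψ W`, then `P` carries a gluing witness
`kC', kW'` for `ψ` and a Riemannian `γ'` with `kC'^* γ' = kC^* γ`, `kW'^* γ' = kW^* γ`.
[cite: HirschDT1976, Ch. 8 §2, Thm. 2.1] [cite: ONeill1983, Ch. 3, p. 58] -/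
theorem helper_isometricTransport :
    ∀ (C : Type) [TopologicalSpace C] [T2Space C] [ChartedSpace (EuclideanHalfSpace 4) C]
      [IsManifold (𝓡∂ 4) ∞ C] [CompactSpace C]
      (bC : Literature.Topology.FourManifolds.BoundaryData (𝓡∂ 4) C (𝓡 3))
      (W : Type) [TopologicalSpace W] [T2Space W] [ChartedSpace (EuclideanHalfSpace 4) W]
      [IsManifold (𝓡∂ 4) ∞ W] [CompactSpace W]
      (bW : Literature.Topology.FourManifolds.BoundaryData (𝓡∂ 4) W (𝓡 3))
      (ψ : bC.carrier ≃ₘ⟮𝓡 3, 𝓡 3⟯ bW.carrier)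
      (X : Type) [TopologicalSpace X] [ChartedSpace (EuclideanSpace ℝ (Fin 4)) X]
      [IsManifold (𝓡 4) ∞ X]
      (P : Type) [TopologicalSpace P] [ChartedSpace (EuclideanSpace ℝ (Fin 4)) P]
      [IsManifold (𝓡 4) ∞ P]
      (kC : C → X) (kW : W → X)
      (γ : Literature.Geometry.Lorentzian.PseudoRiemannianMetric (𝓡 4) ∞ (EuclideanSpace ℝ (Fin 4))
        (TangentSpace (𝓡 4) : X → Type _)),
      Manifold.IsSmoothEmbedding (𝓡∂ 4) (𝓡 4) ∞ kC → Manifold.IsSmoothEmbedding (𝓡∂ 4) (𝓡 4) ∞ kW →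
      Set.range kC ∪ Set.range kW = Set.univ →
      (∀ a b, kC a = kW b ↔ ∃ z, a = bC.incl z ∧ b = bW.incl (ψ z)) →
      γ.IsRiemannian →
      Literature.Topology.FourManifolds.IsBoundaryGluing bC bW ψ (𝓡 4) P →
      ∃ (kC' : C → P) (kW' : W → P)
        (γ' : Literature.Geometry.Lorentzian.PseudoRiemannianMetric (𝓡 4) ∞ (EuclideanSpace ℝ (Fin 4))
          (TangentSpace (𝓡 4) : P → Type _)),
        Manifold.IsSmoothEmbedding (𝓡∂ 4) (𝓡 4) ∞ kC' ∧ Manifold.IsSmoothEmbedding (𝓡∂ 4) (𝓡 4) ∞ kW' ∧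
        Set.range kC' ∪ Set.range kW' = Set.univ ∧
        (∀ a b, kC' a = kW' b ↔ ∃ z, a = bC.incl z ∧ b = bW.incl (ψ z)) ∧
        γ'.IsRiemannian ∧
        (∀ c, Literature.Geometry.Lorentzian.pullbackBilin (I := 𝓡 4) (I' := 𝓡∂ 4) kC' γ'.val c =
          Literature.Geometry.Lorentzian.pullbackBilin (I := 𝓡 4) (I' := 𝓡∂ 4) kC γ.val c) ∧
        (∀ w, Literature.Geometry.Lorentzian.pullbackBilin (I := 𝓡 4) (I' := 𝓡∂ 4) kW' γ'.val w =
          Literature.Geometry.Lorentzian.pullbackBilin (I := 𝓡 4) (I' := 𝓡∂ 4) kW γ.val w) := by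
  intro C _ _ _ _ _ bC W _ _ _ _ _ bW ψ X _ _ _ P _ _ _ kC kW γ hkC hkW hcov hseam hγ hP
  exact isometricTransport C bC W bW ψ X P kC kW γ hkC hkW hcov hseam hγ hP

end Summit.SmoothPoincare4.SmoothPoincare4.Theorems.CorkRegluingBudget

end
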